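import Literature.IUT.HodgeTheaters.GoodLocalFrobenioidOfGaloisCdashRam
import Literature.IUT.HodgeTheaters.GaloisCosetFieldsRamification
import HarnessLib

/-!
# [IUTchI] Example 3.3 (iii) (d): the ramification clause `hbaseRam` DISCHARGED at the genuine datum `k̄/K_v`

Mochizuki, *Inter-universal Teichmüller theory I*, kurims manuscript (May 2020), Example 3.3 (iii) (d), p. 79
[claim: Mochizuki2012, status: disputed]: "(d) the category `C⊢_v` may be reconstructed category-theoretically from
`F̲_v` [cf. [FrdI], Corollary 4.11, (iii); [FrdII], Theorem 1.2, (i); (a), (c) above]" — nothing of the series is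
asserted; no side is taken on [IUTchIII] Cor. 3.12.  Mochizuki, *The absolute anabelian geometry of hyperbolic curves*
(2004), Prop. 1.2.1 (v) p. 10 [cite: MochizukiAbsAnab2004, Prop 1.2.1 (v) p.10] ("the ramification indices of `K₁`, `K₂`
over `ℚ_p` coincide"; PROVED in the tree).

PROOF-ONLY (abc-iut cell, seat abc-iut-L5-t16 gen 6; row E33iii/d-hram of `plan/L5/SUBDAG-IUTchI-Ex33-Ex34.md`,
step 3/3), 0 definitions, no new Prop fact.  After abc-iut-w4-d047's `GoodLocalFrobenioidOfGaloisCdashRam.lean` the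
only non-fact residual of clause (d) over the REAL bases was the base-level ramification clause `hbaseRam` (every
self-equivalence `E` of `𝓑(Π_v)⁰ = CosetCat Π_v` and every `A` admit `ord(𝒪^▷_{K_A}) ≅ ord(𝒪^▷_{K_{E A}})` over
`ord(p_v)`, `K_A` the field under `A`).  THIS FILE proves it for the GENUINE input datum
`GaloisValDatum.ofComplete p k` (`k = K_v`, `Ω = k̄`):
* `exists_continuousMulEquiv_of_map_ker_eq` — a bicontinuous automorphism `φ` of `Π_v` with `φ(Δ_v) = Δ_v`
  (`Δ_v = Ker(Π_v ↠ G_v)`; [AbsAnab] Lem. 1.3.8 in the shape `hΔ`, FACT F-0007) DESCENDS along the open surjection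
  `aug : Π_v ↠ G_v` to a bicontinuous automorphism `φ̄` of `G_v` (`φ̄ ∘ aug = aug ∘ φ`);
* `GoodLocalFrobenioid.hbaseRam_ofComplete` — `E` acts on objects through `φ` up to conjugacy (abc-iut-L1's
  `BaseGaloisSystem.exists_continuousMulEquiv_forall_obj_conj_of_cosetCat_equivalence`), so `aug((E A).sg) = ψ(aug(A.sg))`
  for the bicontinuous automorphism `ψ = Inn(aug c)⁻¹ ∘ φ̄` of `G_v`; conclude by
  `GaloisValDatum.exists_ordInt_mulEquiv_fieldObj_of_map_eq` ([AbsAnab] Prop. 1.2.1 (v) on the fixed fields);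
* `GoodLocalFrobenioid.cdashFromF_ofGalois_ofComplete` (`_of_isSlimGroup`) — hence **(d) over the REAL bases
  `𝓑(Π_v)⁰ ⊇ 𝓑(G_v)⁰`, `G_v = Gal(k̄/k)`, from `hΔ` and slimness ONLY**;
* `InitialThetaData.cdashFromF_goodLocalFrobenioidOfEmb` — **(d) AT THE PRINTED OBJECT** of abc-iut-L5-t2's Def. 3.1
  datum from the datum's openness `hX`, density of `K` in `k`, and the two NAMED anabelian inputs in tree shape
  (`hΔC` = [AbsAnab] Lem. 1.3.1 / FACT F-0004 first conjunct, `hΔ` = [AbsAnab] Lem. 1.3.8 / FACT F-0007) — NO `hram`.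
-/

noncomputable section

namespace Literature.IUT.HodgeTheaters

open CategoryTheory Opposite Literature.AnabelianGeometry.SemiGraphs Literature.AlgebraicGeometry.Frobenioids
open Literature.AlgebraicGeometry.Frobenioids.PadicFrd Literature.AnabelianGeometry.AbsoluteAnabelian Topology

/-! ### Descent of automorphisms along `Π_v ↠ G_v` -/

/-- **Descent along an open surjection.**  For an open continuous surjective homomorphism `aug : P ↠ G` and a
bicontinuous automorphism `φ` of `P` carrying `Ker(aug)` onto itself, there is a bicontinuous automorphism `φ̄` of
`G` with `φ̄ ∘ aug = aug ∘ φ` (algebra: `G ≅ P/Ker(aug)`; topology: `aug` is a quotient map).  Applied to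
`aug : Π_v ↠ G_v`, `Ker = Δ_v` preserved by [AbsAnab] Lem. 1.3.8. [cite: MochizukiAbsAnab2004, Lem 1.3.8 p.17] -/
theorem exists_continuousMulEquiv_of_map_ker_eq {P G : Type*} [Group P] [TopologicalSpace P] [Group G]
    [TopologicalSpace G] (aug : P →* G) (hc : Continuous aug) (hs : Function.Surjective aug) (ho : IsOpenMap aug)
    (φ : P ≃ₜ* P) (hφ : aug.ker.map φ.toMulEquiv.toMonoidHom = aug.ker) :
    ∃ ψ : G ≃ₜ* G, ∀ x : P, ψ (aug x) = aug (φ x) := by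
  -- `φ` and `φ⁻¹` preserve `Ker(aug)`
  have hker : ∀ x, x ∈ aug.ker → φ x ∈ aug.ker := fun x hx => by
    rw [← hφ]
    exact ⟨x, hx, rfl⟩
  have hker' : ∀ x, x ∈ aug.ker → φ.symm x ∈ aug.ker := fun x hx => by
    rw [← hφ] at hx
    obtain ⟨y, hy, rfl⟩ := hx
    change φ.symm (φ y) ∈ aug.ker
    rw [ContinuousMulEquiv.symm_apply_apply]
    exact hy
  -- the induced endomorphisms of `G = P/Ker(aug)`
  have h₁ : aug.ker ≤ (aug.comp φ.toMulEquiv.toMonoidHom).ker := fun x hx =>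
    (MonoidHom.mem_ker).mpr ((MonoidHom.mem_ker).mp (hker x hx))
  have h₂ : aug.ker ≤ (aug.comp φ.symm.toMulEquiv.toMonoidHom).ker := fun x hx =>
    (MonoidHom.mem_ker).mpr ((MonoidHom.mem_ker).mp (hker' x hx))
  let f : G →* G := aug.liftOfSurjective hs ⟨aug.comp φ.toMulEquiv.toMonoidHom, h₁⟩
  let g : G →* G := aug.liftOfSurjective hs ⟨aug.comp φ.symm.toMulEquiv.toMonoidHom, h₂⟩
  have hf : ∀ x, f (aug x) = aug (φ x) := fun x =>
    MonoidHom.liftOfRightInverse_comp_apply aug _ _ ⟨aug.comp φ.toMulEquiv.toMonoidHom, h₁⟩ x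
  have hg : ∀ x, g (aug x) = aug (φ.symm x) := fun x =>
    MonoidHom.liftOfRightInverse_comp_apply aug _ _ ⟨aug.comp φ.symm.toMulEquiv.toMonoidHom, h₂⟩ x
  have hgf : ∀ y, g (f y) = y := fun y => by
    obtain ⟨x, rfl⟩ := hs y
    rw [hf, hg, ContinuousMulEquiv.symm_apply_apply]
  have hfg : ∀ y, f (g y) = y := fun y => by
    obtain ⟨x, rfl⟩ := hs y
    rw [hg, hf, ContinuousMulEquiv.apply_symm_apply]
  -- continuity: `aug` is a quotient map
  have hq : IsQuotientMap aug := ho.isQuotientMap hc hs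
  have hfc : Continuous f := by
    refine hq.continuous_iff.mpr ?_
    have : (f : G → G) ∘ aug = aug ∘ φ := funext fun x => hf x
    rw [this]
    exact hc.comp φ.continuous
  have hgc : Continuous g := by
    refine hq.continuous_iff.mpr ?_
    have : (g : G → G) ∘ aug = aug ∘ φ.symm := funext fun x => hg x
    rw [this]
    exact hc.comp φ.symm.continuous
  exact ⟨{ toFun := f, invFun := g, left_inv := hgf, right_inv := hfg, map_mul' := f.map_mul,
           continuous_toFun := hfc, continuous_invFun := hgc }, hf⟩

namespace GoodLocalFrobenioid

section OfComplete

variable (p : ℕ) [Fact p.Prime] (k : Type) [NontriviallyNormedField k] [CompleteSpace k] [IsUltrametricDist k]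
  [NormedAlgebra ℚ_[p] k] [FiniteDimensional ℚ_[p] k]
  {P : Type} [Group P] [TopologicalSpace P]
  (aug : P →* (GaloisValDatum.ofComplete p k).Gal) (hc : Continuous aug) (hs : Function.Surjective aug)
  (ho : IsOpenMap aug) (Kv : Type) [Field Kv] [ValuativeRel Kv] (hp : ((p : Kv)) ∈ PadicFrd.intNonzero Kv)

include hc hs in
/-- **The base-level ramification clause `hbaseRam` HOLDS at the genuine datum `k̄/k`.**  For `Π_v` profinite-tempered
and second countable over `G_v = Gal(k̄/k)` (`aug : Π_v ↠ G_v` open continuous surjective) with `hΔ` ([AbsAnab]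
Lem. 1.3.8, FACT F-0007 shape), every self-equivalence `E` of `𝓑(Π_v)⁰ = CosetCat Π_v` and every object `A` admit an
isomorphism `ord(𝒪^▷_{K_A}) ≅ ord(𝒪^▷_{K_{E A}})` over `ord(p_v)` (`K_A = k̄^{aug(A)}`): `E(A) = Π_v/c⁻¹φ(H)c` for a
bicontinuous `φ` (abc-iut-L1's `exists_continuousMulEquiv_forall_obj_conj_of_cosetCat_equivalence`), `φ` descends to
`φ̄` on `G_v`, and `aug((E A).sg) = ψ(aug(A.sg))` for `ψ = Inn((aug c)⁻¹) ∘ φ̄`; then [AbsAnab] Prop. 1.2.1 (v) on the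
fixed fields (`GaloisValDatum.exists_ordInt_mulEquiv_fieldObj_of_map_eq`).
([IUTchI] Ex 3.3 (iii) (d) p.79) [claim: Mochizuki2012, status: disputed] -/
theorem hbaseRam_ofComplete [IsTopologicalGroup P] [SecondCountableTopology P] (hP : IsTempered P)
    (hΔ : ∀ φ : P ≃ₜ* P, aug.ker.map φ.toMulEquiv.toMonoidHom = aug.ker)
    (E : CosetCat P ≌ CosetCat P) (A : CosetCat P) :
    ∃ ι : OrdInt ((CosetCat.push aug ho ⋙ (GaloisValDatum.ofComplete p k).fieldFunctor).obj A).K ≃*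
        OrdInt ((CosetCat.push aug ho ⋙ (GaloisValDatum.ofComplete p k).fieldFunctor).obj (E.functor.obj A)).K,
      ι (Associates.mk ⟨((p : ℕ) : ((CosetCat.push aug ho ⋙ (GaloisValDatum.ofComplete p k).fieldFunctor).obj A).K),
          ((CosetCat.push aug ho ⋙ (GaloisValDatum.ofComplete p k).fieldFunctor).obj A).p_mem⟩) =
        Associates.mk ⟨((p : ℕ) : ((CosetCat.push aug ho ⋙
            (GaloisValDatum.ofComplete p k).fieldFunctor).obj (E.functor.obj A)).K),
          ((CosetCat.push aug ho ⋙ (GaloisValDatum.ofComplete p k).fieldFunctor).obj (E.functor.obj A)).p_mem⟩ := by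
  -- `E` acts on objects through a bicontinuous `φ` up to conjugacy
  obtain ⟨φ, hφ⟩ :=
    BaseGaloisSystem.exists_continuousMulEquiv_forall_obj_conj_of_cosetCat_equivalence hP hP (E := E)
  obtain ⟨c, hc'⟩ := hφ A
  -- `φ` descends to `φ̄` on `G_v`
  obtain ⟨ψ₀, hψ₀⟩ := exists_continuousMulEquiv_of_map_ker_eq aug hc hs ho φ (hΔ φ)
  -- `ψ = Inn((aug c)⁻¹) ∘ φ̄`
  let γ : (GaloisValDatum.ofComplete p k).Gal := aug c
  let ψ : (GaloisValDatum.ofComplete p k).Gal ≃ₜ* (GaloisValDatum.ofComplete p k).Gal :=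
    { toFun := fun g => γ⁻¹ * ψ₀ g * γ
      invFun := fun g => ψ₀.symm (γ * g * γ⁻¹)
      left_inv := fun g => by
        change ψ₀.symm (γ * (γ⁻¹ * ψ₀ g * γ) * γ⁻¹) = g
        rw [show γ * (γ⁻¹ * ψ₀ g * γ) * γ⁻¹ = ψ₀ g by group]
        exact ContinuousMulEquiv.symm_apply_apply ψ₀ g
      right_inv := fun g => by
        change γ⁻¹ * ψ₀ (ψ₀.symm (γ * g * γ⁻¹)) * γ = g
        rw [ContinuousMulEquiv.apply_symm_apply]
        group
      map_mul' := fun g h => by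
        rw [map_mul]
        group
      continuous_toFun := (continuous_const.mul ψ₀.continuous).mul continuous_const
      continuous_invFun := ψ₀.symm.continuous.comp ((continuous_const.mul continuous_id).mul continuous_const) }
  have hψ : ∀ x : P, ψ (aug x) = aug (c⁻¹ * φ x * c) := fun x => by
    change γ⁻¹ * ψ₀ (aug x) * γ = _
    rw [hψ₀, map_mul, map_mul, map_inv]
  -- `aug((E A).sg) = ψ(aug(A.sg))`
  have hXY : ((CosetCat.push aug ho).obj (E.functor.obj A)).sg.toSubgroup =
      ((CosetCat.push aug ho).obj A).sg.toSubgroup.map ψ.toMulEquiv.toMonoidHom := by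
    change (E.functor.obj A).sg.toSubgroup.map aug = (A.sg.toSubgroup.map aug).map ψ.toMulEquiv.toMonoidHom
    ext h
    simp only [Subgroup.mem_map]
    constructor
    · rintro ⟨y, hy, rfl⟩
      refine ⟨aug (φ.symm (c * y * c⁻¹)), ⟨φ.symm (c * y * c⁻¹), ?_, rfl⟩, ?_⟩
      · refine (hc' _).mpr ?_
        rw [ContinuousMulEquiv.apply_symm_apply, show c⁻¹ * (c * y * c⁻¹) * c = y by group]
        exact hy
      · change ψ (aug _) = aug y
        rw [hψ, ContinuousMulEquiv.apply_symm_apply, show c⁻¹ * (c * y * c⁻¹) * c = y by group]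
    · rintro ⟨_, ⟨x, hx, rfl⟩, rfl⟩
      refine ⟨c⁻¹ * φ x * c, (hc' x).mp hx, ?_⟩
      change aug (c⁻¹ * φ x * c) = ψ (aug x)
      rw [hψ]
  exact GaloisValDatum.exists_ordInt_mulEquiv_fieldObj_of_map_eq p k ψ _ _ hXY

include hc hs in
/-- **[IUTchI] Ex. 3.3 (iii) (d) over the REAL bases at the genuine datum `k̄/K_v`, from `hΔ` and slimness ONLY**: for
`Π_v` profinite-tempered and second countable over `G_v = Gal(k̄/k)`, given [AbsAnab] Lem. 1.3.8 in the shape `hΔ`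
(FACT F-0007) and the slimness of `𝓑(Π_v)⁰`, the category `C⊢_v` is reconstructible from `F̲_v = C_v`
(abc-iut-w4-d047's `cdashFromF_ofGalois_of_baseRam` with `hbaseRam` DISCHARGED by `hbaseRam_ofComplete`).
([IUTchI] Ex 3.3 (iii) (d) p.79) [claim: Mochizuki2012, status: disputed] -/
theorem cdashFromF_ofGalois_ofComplete [IsTopologicalGroup P] [SecondCountableTopology P] (hP : IsTempered P)
    (hΔ : ∀ φ : P ≃ₜ* P, aug.ker.map φ.toMulEquiv.toMonoidHom = aug.ker) (hsl : IsSlim (CosetCat P)) :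
    (ofGalois (GaloisValDatum.ofComplete p k) aug hc hs ho Kv hp).CdashFromF :=
  cdashFromF_ofGalois_of_baseRam (GaloisValDatum.ofComplete p k) aug hc hs ho Kv hp hP hΔ hsl
    (hbaseRam_ofComplete p k aug hc hs ho hP hΔ)

include hc hs in
/-- The same with slimness in the printed GROUP form (`Π_v` slim, abc-iut-L1's `PadicFrd.isSlim_cosetCat_of_isSlimGroup`).
([IUTchI] Ex 3.3 (iii) (d) p.79) [claim: Mochizuki2012, status: disputed] -/
theorem cdashFromF_ofGalois_ofComplete_of_isSlimGroup [IsTopologicalGroup P] [SecondCountableTopology P]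
    [CompactSpace P] [TotallyDisconnectedSpace P] (hP : IsTempered P)
    (hΔ : ∀ φ : P ≃ₜ* P, aug.ker.map φ.toMulEquiv.toMonoidHom = aug.ker) (hZ : IsSlimGroup P) :
    (ofGalois (GaloisValDatum.ofComplete p k) aug hc hs ho Kv hp).CdashFromF :=
  cdashFromF_ofGalois_ofComplete p k aug hc hs ho Kv hp hP hΔ (PadicFrd.isSlim_cosetCat_of_isSlimGroup hZ)

end OfComplete

end GoodLocalFrobenioid

/-! ### (d) for the initial Θ-datum at `v̲ ∈ V̲^good ∩ V̲^non`, `K_v̲ = k` — without `hram` -/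

noncomputable section Datum

universe u v

variable {F : Type u} {K : Type v} {Fbar : Type} [Field F] [NumberField F] [Field K] [NumberField K]
  [Algebra F K] [Field Fbar] [Algebra F Fbar] [Algebra K Fbar] [IsScalarTower F K Fbar] [Normal K Fbar]
  {E : WeierstrassCurve F} [E.IsElliptic] {l : ℕ} {Pb : BadPlacePredicates K}
  (D : InitialThetaData F K Fbar E l Pb) (p : ℕ) [Fact p.Prime]
  (k : Type) [NontriviallyNormedField k] [CompleteSpace k] [IsUltrametricDist k] [NormedAlgebra ℚ_[p] k]
  [FiniteDimensional ℚ_[p] k] [Algebra K k]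

namespace InitialThetaData

/-- **[IUTchI] Ex. 3.3 (iii) (d) AT THE PRINTED OBJECT** `goodLocalFrobenioidOfEmb` (abc-iut-L5-t2's Def. 3.1 datum `D`
at `v̲ ∈ V̲^good ∩ V̲^non`, `K_v̲ = k`, `Π_v̲ := Π_{X̲→_K} ×_{G_K} Gal(k̄/k)`, along `ι : F̄ → k̄`): `C⊢_v̲` is
reconstructible from `F̲_v̲ = C_v̲`, GIVEN the datum's openness `hX` (Def. 3.1 (f)), the density of `K` in `k`
(Galois-countability), the slimness of `Δ_C` ([AbsAnab] Lem. 1.3.1, FACT F-0004, tree shape `IsSlimGroup D.DeltaC`) and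
[AbsAnab] Lem. 1.3.8 in the shape `hΔ` (FACT F-0007) — the ramification clause `hram` of abc-iut-w4-d047's
`cdashFromF_goodLocalFrobenioidOfEmb_of` being DISCHARGED ([AbsAnab] Prop. 1.2.1 (v), proved in the tree, on the fixed
fields of `k̄`). ([IUTchI] Ex 3.3 (iii) (d) p.79) [claim: Mochizuki2012, status: disputed] -/
theorem cdashFromF_goodLocalFrobenioidOfEmb [SecondCountableTopology D.PiC]
    (ι : Fbar →ₐ[K] AlgebraicClosure k) (hX : IsOpen (D.PiXarrow : Set D.PiC)) (hd : DenseRange (algebraMap K k))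
    (hΔC : IsSlimGroup D.DeltaC)
    (hΔ : ∀ φ : D.PiLoc D.PiXarrow (localToGF F k ι) ≃ₜ* D.PiLoc D.PiXarrow (localToGF F k ι),
      (D.augLoc D.PiXarrow (localToGF F k ι)).ker.map φ.toMulEquiv.toMonoidHom =
        (D.augLoc D.PiXarrow (localToGF F k ι)).ker) :
    @GoodLocalFrobenioid.CdashFromF p k _ (GaloisValDatum.normVal k) (D.goodLocalFrobenioidOfEmb p k ι hX) := by
  letI := GaloisValDatum.normVal k
  haveI := GaloisValDatum.charZero p k
  haveI : CompactSpace (D.PiLoc D.PiXarrow (localToGF F k ι)) :=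
    D.compactSpace_PiLoc D.PiXarrow (localToGF F k ι) hX (continuous_localToGF F k ι)
  haveI := D.secondCountableTopology_galLoc p k ι hd
  haveI : SecondCountableTopology (D.PiLoc D.PiXarrow (localToGF F k ι)) :=
    (inferInstance : SecondCountableTopology
      ((D.PiLoc D.PiXarrow (localToGF F k ι) : Set (D.PiC × (AlgebraicClosure k ≃ₐ[k] AlgebraicClosure k)))))
  exact GoodLocalFrobenioid.cdashFromF_ofGalois_ofComplete_of_isSlimGroup p k _ _ _ _ k
    (GaloisValDatum.p_mem_normVal p k) IsTempered.of_profinite hΔ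
    (D.isSlimGroup_PiLoc_PiXarrow_of_geom_slim p k hΔC ι hX)

end InitialThetaData

end Datum

end Literature.IUT.HodgeTheaters

end
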